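import Literature.AlgebraicGeometry.Motives.HodgeLieWeightOneGradingTwoProjectors
import Literature.AlgebraicGeometry.Motives.HodgeLieWeightOneSl2CenterCorner
import Literature.RepresentationTheory.GeneralLinear.SL2TripleCornerCommutant
import HarnessLib

/-!
# Weight-one Hodge structures with `dim 𝔤⁺ = dim 𝔤⁰ = 2` and `𝔷 = 0`, IV: `End_Hdg(V) ⊗ ℂ` is the commutant of the
# root vectors, has dimension `k₁² + k₂²`, and its centre is `ℂπ₁ ⊕ ℂπ₂`

Family `hodge`, layer `Literature/AlgebraicGeometry/Motives`; THEOREMS ONLY (no definition, no named fact; D-0026).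
Seventh abstract file of the lane MT-RANK-SEVEN-SIMPLE of the cell `pub-hodgecm2` (COR-CM), seat `b27` gen 40; sequel of
`Motives/HodgeLieWeightOneGradingTwoProjectors` (the complementary real idempotents `π₁, π₂` commuting with `𝔤`, with
`𝔤 = 𝔤π₁ ⊕ 𝔤π₂` two `𝔰𝔩₂`-triples `(Eᵢ, Fᵢ, [Eᵢ,Fᵢ])` over `ℂ`).  Setting as there.

* **`exists_projectorPair_commutant`** — (1) `T ∈ End_Hdg(V) ⊗ ℂ` iff `T` commutes with `P, E₁, F₁, E₂, F₂`
  (Zarhin descent `mem_span_endAlg_of_forall_commute`; `𝔤⁰ = ℂ[E₁,F₁] ⊕ ℂ[E₂,F₂]`); (2) `π₁, π₂` are CENTRAL in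
  `End_Hdg(V) ⊗ ℂ`; (3) **every central element of `End_Hdg(V) ⊗ ℂ` is `c₁π₁ + c₂π₂`** (on the corner `πᵢ` the triple
  `(P, Eᵢ, Fᵢ)` is in isotypic position, `EᵢFᵢ = αᵢPπᵢ`, `FᵢEᵢ = αᵢ(πᵢ − Pπᵢ)`, and the corner commutant has scalar
  centre, `SL2Triple.exists_eq_smul_of_mem_center_corner_commutant`); (4) **`dim_ℂ End_Hdg(V) ⊗ ℂ = k₁² + k₂²`** with
  `kᵢ = rk(Pπᵢ) ≥ 1`, `2(k₁ + k₂) = dim_ℚ V` (`End_Hdg ⊗ ℂ = D₁ ⊕ D₂`, `Dᵢ` the corner commutants,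
  `SL2Triple.finrank_corner_commutant_eq_sq`; `rk πᵢ = 2 rk(Pπᵢ)`, `rk π₁ + rk π₂ = dim V`); (5) `𝔤πᵢ ⊆
  ℂEᵢ + ℂFᵢ + ℂ[Eᵢ,Fᵢ]`.  Classically: `V_ℂ = (std ⊠ 1) ⊗ W₁ ⊕ (1 ⊠ std) ⊗ W₂`, `End_Hdg ⊗ ℂ = End W₁ × End W₂`.

The sequel `Motives/HodgeLieWeightOneGradingTwoCenter` descends: `dim_ℚ End_Hdg(V) = k₁² + k₂²`, the centre of
`End_Hdg(V)` has `ℚ`-dimension `2` with a real quadratic generator, and a rational central zero-divisor would give a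
proper ideal of `𝔥`.

## References

* [MoonenZarhin1999LowDim] B. Moonen, Yu. Zarhin, *Hodge classes on abelian varieties of low dimension*, Math. Ann. 315
  (1999), §2 («`End⁰(X) = End_{Hg} H¹`») and (2.3).
* [Zarhin1983HodgeGroupsK3] Yu. Zarhin, *Hodge groups of K3 surfaces*, J. reine angew. Math. 341 (1983), §2.
* [FultonHarris1991] W. Fulton, J. Harris, *Representation Theory*, GTM 129 (1991), Lecture 11 (§11.1).
* [Humphreys1972] J. E. Humphreys, *Introduction to Lie Algebras and Representation Theory*, GTM 9 (1972), §6.1.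
-/

noncomputable section

open scoped TensorProduct

namespace Literature.AlgebraicGeometry.Motives

universe u

namespace HodgeStructure

open ProjectorBlocks Literature.RepresentationTheory.GeneralLinear

variable {V : Type u} [AddCommGroup V] [Module ℚ V] [Module.Finite ℚ V] [HodgeTensorFacts.{u, u}] {n : ℤ}
  {S : Type u} [Fintype S] [DecidableEq S] {deg : S → ℤ}

/-- **`End_Hdg(V) ⊗ ℂ`, its centre and its dimension when `dim 𝔤⁺ = dim 𝔤⁰ = 2` and `𝔷 = 0`.**  There are root vectors
`Eᵢ ∈ 𝔤⁺`, `Fᵢ ∈ 𝔤⁻` and the complementary real idempotents `π₁, π₂` of `exists_projectorPair`, and `k₁, k₂ ≥ 1` with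
`2(k₁ + k₂) = dim_ℚ V`, such that: `T ∈ End_Hdg(V) ⊗ ℂ` iff `T` commutes with `P, E₁, F₁, E₂, F₂`; `π₁, π₂ ∈
End_Hdg(V) ⊗ ℂ` are central there; every central element of `End_Hdg(V) ⊗ ℂ` is `c₁π₁ + c₂π₂`; `π₁, π₂` are linearly
independent; `dim_ℂ End_Hdg(V) ⊗ ℂ = k₁² + k₂²` (`kᵢ = rk(Pπᵢ)`); `𝔤πᵢ ⊆ ℂEᵢ + ℂFᵢ + ℂ[Eᵢ,Fᵢ]`, `Eᵢπᵢ = Eᵢ ≠ 0`;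
`πᵢ` commutes with `𝔤`.
[cite: MoonenZarhin1999LowDim, §2 and (2.3)] [cite: Zarhin1983HodgeGroupsK3, §2]
[cite: FultonHarris1991, Lecture 11 (§11.1)] [cite: Humphreys1972, §6.1] -/
theorem exists_projectorPair_commutant (H : HodgeStructure V n) (ψ : H.Polarization) (hn : n = 1)
    (e : Module.Basis S ℂ (ℂ ⊗[ℚ] V)) (hF : ∀ a, H.F a = Submodule.span ℂ (e '' {σ | a ≤ deg σ}))
    (hFc : ∀ a, complexConj (H.F a) = Submodule.span ℂ (e '' {σ | deg σ ≤ n - a}))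
    (hdeg : ∀ σ, deg σ = 0 ∨ deg σ = 1) (hcenter : H.hodgeLie ⊓ Subalgebra.toSubmodule H.endAlg = ⊥)
    (hp2 : Module.finrank ℂ (H.hodgeLieC ⊓ Module.End.eigenspace
        (LinearMap.mulLeft ℂ (gradingEnd e deg) - LinearMap.mulRight ℂ (gradingEnd e deg)) 1 : Submodule ℂ _) = 2)
    (h02 : Module.finrank ℂ (H.hodgeLieC ⊓ Module.End.eigenspace
        (LinearMap.mulLeft ℂ (gradingEnd e deg) - LinearMap.mulRight ℂ (gradingEnd e deg)) 0 : Submodule ℂ _) = 2) :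
    ∃ (E₁ F₁ E₂ F₂ π₁ π₂ : Module.End ℂ (ℂ ⊗[ℚ] V)) (k₁ k₂ : ℕ),
      (E₁ ∈ H.hodgeLieC ∧ F₁ ∈ H.hodgeLieC ∧ E₂ ∈ H.hodgeLieC ∧ F₂ ∈ H.hodgeLieC) ∧
      (π₁ * π₁ = π₁ ∧ π₂ * π₂ = π₂ ∧ π₁ * π₂ = 0 ∧ π₂ * π₁ = 0 ∧ π₁ + π₂ = 1) ∧
      ((∀ v, π₁ v = conj (π₁ (conj v))) ∧ (∀ v, π₂ v = conj (π₂ (conj v)))) ∧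
      (π₁ ∈ Submodule.span ℂ ((fun a : Module.End ℚ V => a.baseChange ℂ) '' (H.endAlg : Set (Module.End ℚ V))) ∧
        π₂ ∈ Submodule.span ℂ ((fun a : Module.End ℚ V => a.baseChange ℂ) '' (H.endAlg : Set (Module.End ℚ V)))) ∧
      (∀ T : Module.End ℂ (ℂ ⊗[ℚ] V),
        T ∈ Submodule.span ℂ ((fun a : Module.End ℚ V => a.baseChange ℂ) '' (H.endAlg : Set (Module.End ℚ V))) ↔
          (T * gradingEnd e deg = gradingEnd e deg * T ∧ T * E₁ = E₁ * T ∧ T * F₁ = F₁ * T ∧ T * E₂ = E₂ * T ∧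
            T * F₂ = F₂ * T)) ∧
      (∀ T ∈ Submodule.span ℂ ((fun a : Module.End ℚ V => a.baseChange ℂ) '' (H.endAlg : Set (Module.End ℚ V))),
        T * π₁ = π₁ * T ∧ T * π₂ = π₂ * T) ∧
      (∀ T ∈ Submodule.span ℂ ((fun a : Module.End ℚ V => a.baseChange ℂ) '' (H.endAlg : Set (Module.End ℚ V))),
        (∀ T' ∈ Submodule.span ℂ ((fun a : Module.End ℚ V => a.baseChange ℂ) '' (H.endAlg : Set (Module.End ℚ V))),
          T * T' = T' * T) → ∃ c₁ c₂ : ℂ, T = c₁ • π₁ + c₂ • π₂) ∧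
      (∀ x y : ℂ, x • π₁ + y • π₂ = 0 → x = 0 ∧ y = 0) ∧
      (Module.finrank ℂ (Submodule.span ℂ ((fun a : Module.End ℚ V => a.baseChange ℂ) ''
          (H.endAlg : Set (Module.End ℚ V)))) = k₁ ^ 2 + k₂ ^ 2 ∧
        0 < k₁ ∧ 0 < k₂ ∧ 2 * (k₁ + k₂) = Module.finrank ℚ V) ∧
      ((∀ Y ∈ H.hodgeLieC, Y * π₁ ∈ Submodule.span ℂ (Set.range ![E₁, F₁, E₁ * F₁ - F₁ * E₁])) ∧
        (∀ Y ∈ H.hodgeLieC, Y * π₂ ∈ Submodule.span ℂ (Set.range ![E₂, F₂, E₂ * F₂ - F₂ * E₂]))) ∧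
      (E₁ * π₁ = E₁ ∧ E₁ ≠ 0 ∧ E₂ * π₂ = E₂ ∧ E₂ ≠ 0) ∧
      ((∀ Y ∈ H.hodgeLieC, π₁ * Y = Y * π₁) ∧ (∀ Y ∈ H.hodgeLieC, π₂ * Y = Y * π₂)) := by
  classical
  have hPP := gradingEnd_mul_gradingEnd_of_deg e hdeg
  obtain ⟨E₁, E₂, F₁, F₂, π₁, π₂, α₁, α₂, ⟨hE₁g, hE₂g, hF₁g, hF₂g⟩, ⟨hE₁, hE₂, hF₁m, hF₂m⟩, ⟨hF₁, hF₂⟩, hind,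
    hspanE, hspanF, ⟨k12, k12', k21, k21'⟩, ⟨hα₁, hα₂, -, -, hEFE₁, hFEF₁, hEFE₂, hFEF₂⟩, ⟨hπ₁, hπ₂⟩,
    ⟨hππ₁, hππ₂, hπ₁π₂, hπ₂π₁, hsum1⟩, ⟨hPπ₁, hPπ₂⟩, ⟨hre₁, hre₂⟩, ⟨hπ₁comm, hπ₂comm⟩, ⟨hπ₁span, hπ₂span⟩,
    ⟨hπ₁0, hπ₂0⟩, hG0span⟩ := exists_projectorPair H ψ hn e hF hFc hdeg hcenter hp2 h02
  set P := gradingEnd e deg with hP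
  set Θ : Module.End ℂ (ℂ ⊗[ℚ] V) := (2 : ℂ) • P - 1 with hΘdef
  set A : Submodule ℂ (Module.End ℂ (ℂ ⊗[ℚ] V)) :=
    Submodule.span ℂ ((fun a : Module.End ℚ V => a.baseChange ℂ) '' (H.endAlg : Set (Module.End ℚ V))) with hA
  obtain ⟨hPE₁, hE₁P, -, hPF₁, hF₁P, -⟩ := corner_identities (K := ℂ) hPP hE₁ hF₁m
  obtain ⟨hPE₂, hE₂P, -, hPF₂, hF₂P, -⟩ := corner_identities (K := ℂ) hPP hE₂ hF₂m
  obtain ⟨-, hPπ₁', -, hEπ₁, hπE₁, hFπ₁, hπF₁, -⟩ := rootProjector_identities e hdeg hE₁ hF₁m hα₁ hEFE₁ hFEF₁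
  obtain ⟨-, hPπ₂', -, hEπ₂, hπE₂, hFπ₂, hπF₂, -⟩ := rootProjector_identities e hdeg hE₂ hF₂m hα₂ hEFE₂ hFEF₂
  rw [← hπ₁] at hPπ₁' hEπ₁ hπE₁ hFπ₁ hπF₁
  rw [← hπ₂] at hPπ₂' hEπ₂ hπE₂ hFπ₂ hπF₂
  rw [← hP] at hPπ₁' hPπ₂'
  have hEE₁₂ : E₁ * E₂ = 0 := mul_eq_zero_of_plus_plus (K := ℂ) hPP hE₁ hE₂
  have hEE₂₁ : E₂ * E₁ = 0 := mul_eq_zero_of_plus_plus (K := ℂ) hPP hE₂ hE₁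
  have hFF₁₂ : F₁ * F₂ = 0 := mul_eq_zero_of_minus_minus (K := ℂ) hPP hF₁m hF₂m
  have hFF₂₁ : F₂ * F₁ = 0 := mul_eq_zero_of_minus_minus (K := ℂ) hPP hF₂m hF₁m
  -- `π₁` kills the second triple, `π₂` the first
  have hπ₁E₂ : π₁ * E₂ = 0 := by rw [← hπE₂, ← mul_assoc, hπ₁π₂, zero_mul]
  have hE₂π₁ : E₂ * π₁ = 0 := by rw [← hEπ₂, mul_assoc, hπ₂π₁, mul_zero]
  have hπ₁F₂ : π₁ * F₂ = 0 := by rw [← hπF₂, ← mul_assoc, hπ₁π₂, zero_mul]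
  have hF₂π₁ : F₂ * π₁ = 0 := by rw [← hFπ₂, mul_assoc, hπ₂π₁, mul_zero]
  have hπ₂E₁ : π₂ * E₁ = 0 := by rw [← hπE₁, ← mul_assoc, hπ₂π₁, zero_mul]
  have hE₁π₂ : E₁ * π₂ = 0 := by rw [← hEπ₁, mul_assoc, hπ₁π₂, mul_zero]
  have hπ₂F₁ : π₂ * F₁ = 0 := by rw [← hπF₁, ← mul_assoc, hπ₂π₁, zero_mul]
  have hF₁π₂ : F₁ * π₂ = 0 := by rw [← hFπ₁, mul_assoc, hπ₁π₂, mul_zero]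
  -- isotypic position on the corners: `EᵢFᵢ = αᵢPπᵢ`, `FᵢEᵢ = αᵢ(πᵢ − Pπᵢ)`
  have hEF₁ : E₁ * F₁ = α₁ • (P * π₁) := by rw [hPπ₁', smul_smul, mul_inv_cancel₀ hα₁, one_smul]
  have hEF₂ : E₂ * F₂ = α₂ • (P * π₂) := by rw [hPπ₂', smul_smul, mul_inv_cancel₀ hα₂, one_smul]
  have hFE₁ : F₁ * E₁ = α₁ • (π₁ - P * π₁) := by
    rw [smul_sub, ← hEF₁, hπ₁, smul_smul, mul_inv_cancel₀ hα₁, one_smul, add_sub_cancel_left]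
  have hFE₂ : F₂ * E₂ = α₂ • (π₂ - P * π₂) := by
    rw [smul_sub, ← hEF₂, hπ₂, smul_smul, mul_inv_cancel₀ hα₂, one_smul, add_sub_cancel_left]
  have hE₁0 : E₁ ≠ 0 := fun h => one_ne_zero (hind 1 0 (by rw [h, smul_zero, zero_smul, add_zero])).1
  have hE₂0 : E₂ ≠ 0 := fun h => one_ne_zero (hind 0 1 (by rw [h, smul_zero, zero_smul, zero_add])).2
  have hPπ₁0 : P * π₁ ≠ 0 := by
    intro h
    obtain ⟨h1, -⟩ := mul_conjOp_ne_zero_of_plus H ψ hn e hF hFc hdeg hE₁g hE₁ hE₁0 hF₁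
    exact h1 (by rw [hEF₁, h, smul_zero])
  have hPπ₂0 : P * π₂ ≠ 0 := by
    intro h
    obtain ⟨h1, -⟩ := mul_conjOp_ne_zero_of_plus H ψ hn e hF hFc hdeg hE₂g hE₂ hE₂0 hF₂
    exact h1 (by rw [hEF₂, h, smul_zero])
  -- (1) the membership criterion
  have hcrit : ∀ T : Module.End ℂ (ℂ ⊗[ℚ] V), T ∈ A ↔
      (T * P = P * T ∧ T * E₁ = E₁ * T ∧ T * F₁ = F₁ * T ∧ T * E₂ = E₂ * T ∧ T * F₂ = F₂ * T) := by
    intro T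
    constructor
    · intro hT
      have hcomm : ∀ Z ∈ H.hodgeLieC, T * Z = Z * T := by
        intro Z hZ
        induction hT using Submodule.span_induction with
        | mem T' hT' =>
          obtain ⟨a, ha, rfl⟩ := hT'
          exact (commute_baseChange_of_mem_hodgeLieC H hZ ⟨a, ha⟩).symm
        | zero => rw [zero_mul, mul_zero]
        | add T₁ T₂ _ _ h₁ h₂ => rw [add_mul, mul_add, h₁, h₂]
        | smul c T₁ _ h₁ => rw [smul_mul_assoc, mul_smul_comm, h₁]
      have hΘg : Θ ∈ H.hodgeLieC := (theta_mem_gradingZero H hn e hF hFc).1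
      refine ⟨?_, hcomm _ hE₁g, hcomm _ hF₁g, hcomm _ hE₂g, hcomm _ hF₂g⟩
      have h := hcomm _ hΘg
      rw [hΘdef, mul_sub, sub_mul, mul_one, one_mul, mul_smul_comm, smul_mul_assoc, sub_left_inj] at h
      exact smul_right_injective _ (two_ne_zero : (2 : ℂ) ≠ 0) h
    · rintro ⟨hTP, hTE₁, hTF₁, hTE₂, hTF₂⟩
      refine H.mem_span_endAlg_of_forall_commute fun X hX => ?_
      have hY := H.baseChange_mem_hodgeLieC hX
      obtain ⟨gE, gF, gZ⟩ := hodgeLieC_components_mem H e hF hFc hdeg hY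
      rw [← hP] at gE gF gZ
      obtain ⟨c1, c2, c3, hsum⟩ := components_mem_eigenspace_adP (K := ℂ) hPP (X.baseChange ℂ)
      rw [mem_eigenspace_adP_one_iff hPP] at c1
      rw [mem_eigenspace_adP_neg_one_iff hPP] at c2
      rw [mem_eigenspace_adP_zero_iff] at c3
      obtain ⟨x, y, hxy⟩ := hspanE _ gE c1
      obtain ⟨x', y', hxy'⟩ := hspanF _ gF c2
      obtain ⟨a, b, hab⟩ := hG0span _ gZ c3
      rw [← hsum, hxy, hxy', hab]
      simp only [mul_add, add_mul, mul_sub, sub_mul, mul_smul_comm, smul_mul_assoc, ← mul_assoc, hTE₁, hTE₂, hTF₁, hTF₂]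
      simp only [mul_assoc, hTE₁, hTE₂, hTF₁, hTF₂]
  -- (2) `πᵢ` central in `A`
  have hπcomm : ∀ T ∈ A, T * π₁ = π₁ * T ∧ T * π₂ = π₂ * T := by
    intro T hT
    obtain ⟨-, hTE₁, hTF₁, hTE₂, hTF₂⟩ := (hcrit T).1 hT
    constructor
    · rw [hπ₁, mul_smul_comm, smul_mul_assoc, mul_add, add_mul, ← mul_assoc T E₁ F₁, hTE₁, mul_assoc E₁ T F₁, hTF₁,
        ← mul_assoc E₁ F₁ T, ← mul_assoc T F₁ E₁, hTF₁, mul_assoc F₁ T E₁, hTE₁, ← mul_assoc F₁ E₁ T]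
    · rw [hπ₂, mul_smul_comm, smul_mul_assoc, mul_add, add_mul, ← mul_assoc T E₂ F₂, hTE₂, mul_assoc E₂ T F₂, hTF₂,
        ← mul_assoc E₂ F₂ T, ← mul_assoc T F₂ E₂, hTF₂, mul_assoc F₂ T E₂, hTE₂, ← mul_assoc F₂ E₂ T]
  -- the corner commutants `Dᵢ = {T ∈ Cᵢ | Tπᵢ = T = πᵢT}`, `Cᵢ` the commutant of `(P, Eᵢ, Fᵢ)`
  set C₁ : Submodule ℂ (Module.End ℂ (ℂ ⊗[ℚ] V)) :=
    Module.End.eigenspace (LinearMap.mulLeft ℂ P - LinearMap.mulRight ℂ P) 0 ⊓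
      Module.End.eigenspace (LinearMap.mulLeft ℂ E₁ - LinearMap.mulRight ℂ E₁) 0 ⊓
      Module.End.eigenspace (LinearMap.mulLeft ℂ F₁ - LinearMap.mulRight ℂ F₁) 0 with hC₁
  set C₂ : Submodule ℂ (Module.End ℂ (ℂ ⊗[ℚ] V)) :=
    Module.End.eigenspace (LinearMap.mulLeft ℂ P - LinearMap.mulRight ℂ P) 0 ⊓
      Module.End.eigenspace (LinearMap.mulLeft ℂ E₂ - LinearMap.mulRight ℂ E₂) 0 ⊓
      Module.End.eigenspace (LinearMap.mulLeft ℂ F₂ - LinearMap.mulRight ℂ F₂) 0 with hC₂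
  have hC₁mem : ∀ T, T ∈ C₁ ↔ T * P = P * T ∧ T * E₁ = E₁ * T ∧ T * F₁ = F₁ * T := fun T => by
    rw [hC₁, Submodule.mem_inf, Submodule.mem_inf, mem_eigenspace_adP_zero_iff, mem_eigenspace_adP_zero_iff,
      mem_eigenspace_adP_zero_iff]
    exact ⟨fun ⟨⟨h1, h2⟩, h3⟩ => ⟨h1.symm, h2.symm, h3.symm⟩, fun ⟨h1, h2, h3⟩ => ⟨⟨h1.symm, h2.symm⟩, h3.symm⟩⟩
  have hC₂mem : ∀ T, T ∈ C₂ ↔ T * P = P * T ∧ T * E₂ = E₂ * T ∧ T * F₂ = F₂ * T := fun T => by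
    rw [hC₂, Submodule.mem_inf, Submodule.mem_inf, mem_eigenspace_adP_zero_iff, mem_eigenspace_adP_zero_iff,
      mem_eigenspace_adP_zero_iff]
    exact ⟨fun ⟨⟨h1, h2⟩, h3⟩ => ⟨h1.symm, h2.symm, h3.symm⟩, fun ⟨h1, h2, h3⟩ => ⟨⟨h1.symm, h2.symm⟩, h3.symm⟩⟩
  set D₁ : Submodule ℂ (Module.End ℂ (ℂ ⊗[ℚ] V)) := C₁ ⊓ Module.End.eigenspace (LinearMap.mulRight ℂ π₁) 1 ⊓
    Module.End.eigenspace (LinearMap.mulLeft ℂ π₁) 1 with hD₁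
  set D₂ : Submodule ℂ (Module.End ℂ (ℂ ⊗[ℚ] V)) := C₂ ⊓ Module.End.eigenspace (LinearMap.mulRight ℂ π₂) 1 ⊓
    Module.End.eigenspace (LinearMap.mulLeft ℂ π₂) 1 with hD₂
  have hD₁mem : ∀ T, T ∈ D₁ ↔ T ∈ C₁ ∧ T * π₁ = T ∧ π₁ * T = T := fun T => by
    rw [hD₁, Submodule.mem_inf, Submodule.mem_inf, Module.End.mem_eigenspace_iff, Module.End.mem_eigenspace_iff,
      LinearMap.mulRight_apply, LinearMap.mulLeft_apply, one_smul, and_assoc]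
  have hD₂mem : ∀ T, T ∈ D₂ ↔ T ∈ C₂ ∧ T * π₂ = T ∧ π₂ * T = T := fun T => by
    rw [hD₂, Submodule.mem_inf, Submodule.mem_inf, Module.End.mem_eigenspace_iff, Module.End.mem_eigenspace_iff,
      LinearMap.mulRight_apply, LinearMap.mulLeft_apply, one_smul, and_assoc]
  -- `Dᵢ ≤ A` and `A ∋ T ⟹ Tπᵢ ∈ Dᵢ`
  have hD₁A : D₁ ≤ A := by
    intro T hT
    obtain ⟨hTC, hTπ, hπT⟩ := (hD₁mem T).1 hT
    obtain ⟨hTP, hTE₁, hTF₁⟩ := (hC₁mem T).1 hTC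
    refine (hcrit T).2 ⟨hTP, hTE₁, hTF₁, ?_, ?_⟩
    · have h1 : T * E₂ = 0 := by rw [← hTπ, mul_assoc, hπ₁E₂, mul_zero]
      have h2 : E₂ * T = 0 := by rw [← hπT, ← mul_assoc, hE₂π₁, zero_mul]
      rw [h1, h2]
    · have h1 : T * F₂ = 0 := by rw [← hTπ, mul_assoc, hπ₁F₂, mul_zero]
      have h2 : F₂ * T = 0 := by rw [← hπT, ← mul_assoc, hF₂π₁, zero_mul]
      rw [h1, h2]
  have hD₂A : D₂ ≤ A := by
    intro T hT
    obtain ⟨hTC, hTπ, hπT⟩ := (hD₂mem T).1 hT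
    obtain ⟨hTP, hTE₂, hTF₂⟩ := (hC₂mem T).1 hTC
    refine (hcrit T).2 ⟨hTP, ?_, ?_, hTE₂, hTF₂⟩
    · have h1 : T * E₁ = 0 := by rw [← hTπ, mul_assoc, hπ₂E₁, mul_zero]
      have h2 : E₁ * T = 0 := by rw [← hπT, ← mul_assoc, hE₁π₂, zero_mul]
      rw [h1, h2]
    · have h1 : T * F₁ = 0 := by rw [← hTπ, mul_assoc, hπ₂F₁, mul_zero]
      have h2 : F₁ * T = 0 := by rw [← hπT, ← mul_assoc, hF₁π₂, zero_mul]
      rw [h1, h2]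
  have hAD₁ : ∀ T ∈ A, T * π₁ ∈ D₁ := by
    intro T hT
    obtain ⟨hTP, hTE₁, hTF₁, -, -⟩ := (hcrit T).1 hT
    obtain ⟨hTπ₁, -⟩ := hπcomm T hT
    refine (hD₁mem _).2 ⟨(hC₁mem _).2 ⟨?_, ?_, ?_⟩, ?_, ?_⟩
    · rw [mul_assoc, ← hPπ₁, ← mul_assoc, hTP, mul_assoc]
    · rw [mul_assoc, hπE₁, hTE₁, hTπ₁, ← mul_assoc, hEπ₁]
    · rw [mul_assoc, hπF₁, hTF₁, hTπ₁, ← mul_assoc, hFπ₁]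
    · rw [mul_assoc, hππ₁]
    · rw [hTπ₁, ← mul_assoc, hππ₁]
  have hAD₂ : ∀ T ∈ A, T * π₂ ∈ D₂ := by
    intro T hT
    obtain ⟨hTP, -, -, hTE₂, hTF₂⟩ := (hcrit T).1 hT
    obtain ⟨-, hTπ₂⟩ := hπcomm T hT
    refine (hD₂mem _).2 ⟨(hC₂mem _).2 ⟨?_, ?_, ?_⟩, ?_, ?_⟩
    · rw [mul_assoc, ← hPπ₂, ← mul_assoc, hTP, mul_assoc]
    · rw [mul_assoc, hπE₂, hTE₂, hTπ₂, ← mul_assoc, hEπ₂]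
    · rw [mul_assoc, hπF₂, hTF₂, hTπ₂, ← mul_assoc, hFπ₂]
    · rw [mul_assoc, hππ₂]
    · rw [hTπ₂, ← mul_assoc, hππ₂]
  -- (3) the centre
  have hcentre : ∀ T ∈ A, (∀ T' ∈ A, T * T' = T' * T) → ∃ c₁ c₂ : ℂ, T = c₁ • π₁ + c₂ • π₂ := by
    intro T hT hTc
    obtain ⟨hTπ₁, hTπ₂⟩ := hπcomm T hT
    have key : ∀ {Q Eq Fq : Module.End ℂ (ℂ ⊗[ℚ] V)} {αq : ℂ} {Cq Dq : Submodule ℂ (Module.End ℂ (ℂ ⊗[ℚ] V))},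
        αq ≠ 0 → Q * Q = Q → P * Q = Q * P → P * Eq = Eq → Eq * P = 0 → P * Fq = 0 → Fq * P = Fq →
        Eq * Q = Eq → Q * Eq = Eq → Fq * Q = Fq → Q * Fq = Fq → Eq * Fq = αq • (P * Q) →
        Fq * Eq = αq • (Q - P * Q) → P * Q ≠ 0 →
        (∀ T, T ∈ Cq ↔ T * P = P * T ∧ T * Eq = Eq * T ∧ T * Fq = Fq * T) →
        (∀ T, T ∈ Dq ↔ T ∈ Cq ∧ T * Q = T ∧ Q * T = T) → Dq ≤ A → T * Q ∈ Dq → T * Q = Q * T →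
        ∃ c : ℂ, T * Q = c • Q := by
      intro Q Eq Fq αq Cq Dq hαq hQQ hPQ hPEq hEqP hPFq hFqP hEQ hQE hFQ hQF hEFq hFEq hPQ0 hCq hDq hDqA hTQ hTQc
      refine SL2Triple.exists_eq_smul_of_mem_center_corner_commutant hαq hQQ hPQ hPP hPEq hEqP hPFq hFqP hEQ hQE hFQ hQF
        hEFq hFEq hPQ0 hCq hDq hTQ fun T' hT' => ?_
      obtain ⟨-, hT'Q, hQT'⟩ := (hDq T').1 hT'
      have h := hTc T' (hDqA hT')
      rw [mul_assoc, hQT', h, ← hT'Q, mul_assoc, hT'Q, ← hTQc]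
    obtain ⟨c₁, hc₁⟩ := key hα₁ hππ₁ hPπ₁ hPE₁ hE₁P hPF₁ hF₁P hEπ₁ hπE₁ hFπ₁ hπF₁ hEF₁ hFE₁ hPπ₁0 hC₁mem hD₁mem
      hD₁A (hAD₁ T hT) hTπ₁
    obtain ⟨c₂, hc₂⟩ := key hα₂ hππ₂ hPπ₂ hPE₂ hE₂P hPF₂ hF₂P hEπ₂ hπE₂ hFπ₂ hπF₂ hEF₂ hFE₂ hPπ₂0 hC₂mem hD₂mem
      hD₂A (hAD₂ T hT) hTπ₂
    refine ⟨c₁, c₂, ?_⟩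
    rw [← hc₁, ← hc₂, ← mul_add, hsum1, mul_one]
  -- independence of `π₁, π₂`
  have hπind : ∀ x y : ℂ, x • π₁ + y • π₂ = 0 → x = 0 ∧ y = 0 := by
    intro x y h
    have h1 := congrArg (fun T : Module.End ℂ (ℂ ⊗[ℚ] V) => T * π₁) h
    simp only [add_mul, smul_mul_assoc, hππ₁, hπ₂π₁, smul_zero, add_zero, zero_mul] at h1
    have h2 := congrArg (fun T : Module.End ℂ (ℂ ⊗[ℚ] V) => T * π₂) h
    simp only [add_mul, smul_mul_assoc, hππ₂, hπ₁π₂, smul_zero, zero_add, zero_mul] at h2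
    exact ⟨(smul_eq_zero.1 h1).resolve_right hπ₁0, (smul_eq_zero.1 h2).resolve_right hπ₂0⟩
  -- (4) dimension: `A = D₁ ⊕ D₂`, `dim Dᵢ = kᵢ²`
  have hsup : D₁ ⊔ D₂ = A := by
    apply le_antisymm (sup_le hD₁A hD₂A)
    intro T hT
    have hTeq : T = T * π₁ + T * π₂ := by rw [← mul_add, hsum1, mul_one]
    rw [hTeq]
    exact Submodule.add_mem _ (Submodule.mem_sup_left (hAD₁ T hT)) (Submodule.mem_sup_right (hAD₂ T hT))
  have hinf : D₁ ⊓ D₂ = ⊥ := by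
    rw [eq_bot_iff]
    rintro T ⟨h1, h2⟩
    obtain ⟨-, hTπ₁, -⟩ := (hD₁mem T).1 h1
    obtain ⟨-, hTπ₂, -⟩ := (hD₂mem T).1 h2
    rw [Submodule.mem_bot, ← hTπ₁, ← hTπ₂, mul_assoc, hπ₂π₁, mul_zero]
  have hdimA : Module.finrank ℂ A = Module.finrank ℂ (LinearMap.range (P * π₁)) ^ 2 +
      Module.finrank ℂ (LinearMap.range (P * π₂)) ^ 2 := by
    have h := Submodule.finrank_sup_add_finrank_inf_eq D₁ D₂
    rw [hinf, finrank_bot, add_zero, hsup] at h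
    rw [h, SL2Triple.finrank_corner_commutant_eq_sq hα₁ hππ₁ hPπ₁ hPP hPE₁ hE₁P hPF₁ hF₁P hEπ₁ hπE₁ hFπ₁ hπF₁ hEF₁ hFE₁
      hC₁mem hD₁mem, SL2Triple.finrank_corner_commutant_eq_sq hα₂ hππ₂ hPπ₂ hPP hPE₂ hE₂P hPF₂ hF₂P hEπ₂ hπE₂ hFπ₂
      hπF₂ hEF₂ hFE₂ hC₂mem hD₂mem]
  have hk₁ : 0 < Module.finrank ℂ (LinearMap.range (P * π₁)) := by
    rw [Module.finrank_pos_iff_exists_ne_zero]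
    obtain ⟨v, hv⟩ : ∃ v, (P * π₁) v ≠ 0 := by
      by_contra h; push Not at h; exact hPπ₁0 (LinearMap.ext fun v => by rw [h v, LinearMap.zero_apply])
    exact ⟨⟨(P * π₁) v, LinearMap.mem_range_self _ v⟩, fun h => hv (congrArg Subtype.val h)⟩
  have hk₂ : 0 < Module.finrank ℂ (LinearMap.range (P * π₂)) := by
    rw [Module.finrank_pos_iff_exists_ne_zero]
    obtain ⟨v, hv⟩ : ∃ v, (P * π₂) v ≠ 0 := by
      by_contra h; push Not at h; exact hPπ₂0 (LinearMap.ext fun v => by rw [h v, LinearMap.zero_apply])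
    exact ⟨⟨(P * π₂) v, LinearMap.mem_range_self _ v⟩, fun h => hv (congrArg Subtype.val h)⟩
  -- `2 (k₁ + k₂) = dim V`: `rk πᵢ = 2 rk(Pπᵢ)` and `rk π₁ + rk π₂ = dim V_ℂ`
  have hrk₁ := two_mul_finrank_range_corner_eq hα₁ hPP hππ₁ hPπ₁ hEFE₁ hFEF₁ hEF₁ hFE₁
  have hrk₂ := two_mul_finrank_range_corner_eq hα₂ hPP hππ₂ hPπ₂ hEFE₂ hFEF₂ hEF₂ hFE₂
  have hker : LinearMap.ker π₁ = LinearMap.range π₂ := by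
    ext v
    rw [LinearMap.mem_ker, LinearMap.mem_range]
    constructor
    · intro hv
      refine ⟨v, ?_⟩
      have h := congrArg (fun T : Module.End ℂ (ℂ ⊗[ℚ] V) => T v) hsum1
      simp only [LinearMap.add_apply, Module.End.one_apply, hv, zero_add] at h
      exact h
    · rintro ⟨w, rfl⟩
      rw [← Module.End.mul_apply, hπ₁π₂, LinearMap.zero_apply]
  have hdimV : 2 * (Module.finrank ℂ (LinearMap.range (P * π₁)) + Module.finrank ℂ (LinearMap.range (P * π₂))) =
      Module.finrank ℚ V := by
    rw [mul_add, hrk₁, hrk₂, ← hker, LinearMap.finrank_range_add_finrank_ker, Module.finrank_baseChange]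
  -- (5) `𝔤πᵢ ⊆ ℂEᵢ + ℂFᵢ + ℂ[Eᵢ,Fᵢ]`
  have hH₁π₁ : (E₁ * F₁ - F₁ * E₁) * π₁ = E₁ * F₁ - F₁ * E₁ := by rw [sub_mul, mul_assoc, hFπ₁, mul_assoc, hEπ₁]
  have hH₂π₂ : (E₂ * F₂ - F₂ * E₂) * π₂ = E₂ * F₂ - F₂ * E₂ := by rw [sub_mul, mul_assoc, hFπ₂, mul_assoc, hEπ₂]
  have hH₂π₁ : (E₂ * F₂ - F₂ * E₂) * π₁ = 0 := by
    rw [sub_mul, mul_assoc, hF₂π₁, mul_assoc, hE₂π₁, mul_zero, mul_zero, sub_self]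
  have hH₁π₂ : (E₁ * F₁ - F₁ * E₁) * π₂ = 0 := by
    rw [sub_mul, mul_assoc, hF₁π₂, mul_assoc, hE₁π₂, mul_zero, mul_zero, sub_self]
  have hgπ : ∀ {Ea Fa Eb Fb πa : Module.End ℂ (ℂ ⊗[ℚ] V)},
      (∀ X ∈ H.hodgeLieC, P * X * (1 - P) = X → ∃ x y : ℂ, X = x • Ea + y • Eb) →
      (∀ X ∈ H.hodgeLieC, (1 - P) * X * P = X → ∃ x y : ℂ, X = x • Fa + y • Fb) →
      (∀ Z ∈ H.hodgeLieC, P * Z = Z * P → ∃ a b : ℂ, Z = a • (Ea * Fa - Fa * Ea) + b • (Eb * Fb - Fb * Eb)) →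
      Ea * πa = Ea → Eb * πa = 0 → Fa * πa = Fa → Fb * πa = 0 → (Ea * Fa - Fa * Ea) * πa = Ea * Fa - Fa * Ea →
      (Eb * Fb - Fb * Eb) * πa = 0 →
      ∀ Y ∈ H.hodgeLieC, Y * πa ∈ Submodule.span ℂ (Set.range ![Ea, Fa, Ea * Fa - Fa * Ea]) := by
    intro Ea Fa Eb Fb πa hsE hsF hsZ hEa hEb hFa hFb hHa hHb Y hY
    obtain ⟨gE, gF, gZ⟩ := hodgeLieC_components_mem H e hF hFc hdeg hY
    rw [← hP] at gE gF gZ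
    obtain ⟨c1, c2, c3, hsum⟩ := components_mem_eigenspace_adP (K := ℂ) hPP Y
    rw [mem_eigenspace_adP_one_iff hPP] at c1
    rw [mem_eigenspace_adP_neg_one_iff hPP] at c2
    rw [mem_eigenspace_adP_zero_iff] at c3
    obtain ⟨x, y, hxy⟩ := hsE _ gE c1
    obtain ⟨x', y', hxy'⟩ := hsF _ gF c2
    obtain ⟨a, b, hab⟩ := hsZ _ gZ c3
    rw [← hsum, hxy, hxy', hab]
    simp only [add_mul, smul_mul_assoc, hEa, hEb, hFa, hFb, hHa, hHb, smul_zero, add_zero]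
    exact Submodule.add_mem _ (Submodule.add_mem _ (Submodule.smul_mem _ _ (Submodule.subset_span ⟨0, rfl⟩))
      (Submodule.smul_mem _ _ (Submodule.subset_span ⟨1, rfl⟩)))
      (Submodule.smul_mem _ _ (Submodule.subset_span ⟨2, rfl⟩))
  have hgπ₁ := hgπ (πa := π₁) hspanE hspanF hG0span hEπ₁ hE₂π₁ hFπ₁ hF₂π₁ hH₁π₁ hH₂π₁
  have hgπ₂ := hgπ (πa := π₂)
    (fun X hXg hXm => by obtain ⟨x, y, h⟩ := hspanE X hXg hXm; exact ⟨y, x, by rw [h, add_comm]⟩)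
    (fun X hXg hXm => by obtain ⟨x, y, h⟩ := hspanF X hXg hXm; exact ⟨y, x, by rw [h, add_comm]⟩)
    (fun Z hZg hZP => by obtain ⟨a, b, h⟩ := hG0span Z hZg hZP; exact ⟨b, a, by rw [h, add_comm]⟩)
    hEπ₂ hE₁π₂ hFπ₂ hF₁π₂ hH₂π₂ hH₁π₂
  exact ⟨E₁, F₁, E₂, F₂, π₁, π₂, Module.finrank ℂ (LinearMap.range (P * π₁)),
    Module.finrank ℂ (LinearMap.range (P * π₂)), ⟨hE₁g, hF₁g, hE₂g, hF₂g⟩, ⟨hππ₁, hππ₂, hπ₁π₂, hπ₂π₁, hsum1⟩,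
    ⟨hre₁, hre₂⟩, ⟨hπ₁span, hπ₂span⟩, hcrit, hπcomm, hcentre, hπind, ⟨hdimA, hk₁, hk₂, hdimV⟩, ⟨hgπ₁, hgπ₂⟩,
    ⟨hEπ₁, hE₁0, hEπ₂, hE₂0⟩, ⟨hπ₁comm, hπ₂comm⟩⟩

end HodgeStructure

end Literature.AlgebraicGeometry.Motives

end
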